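import Literature.AlgebraicGeometry.Resolution.ExceptionalDivisorChartSections
import Literature.AlgebraicGeometry.Resolution.BlowupAlgebraQuasiRegularChart
import HarnessLib

/-!
# The affine pieces of the exceptional divisor of a quasi-regular blow-up are affine spaces over the centre

Topic: `Literature/AlgebraicGeometry/Resolution`. Theorem-only file. Let `β : X' → M` be a blowing up
along `𝓘 = ker i₀` for a closed immersion `i₀ : B ↪ M`, `E = X' ×_M B` (`j = pr₁`, `q = pr₂`), and
`W ⊆ M` an affine open on which `𝓘(W) = (x₀, …, xₙ)` with `x` a **quasi-regular** sequence of
`A = Γ(M, W)` (the local shape of a regular centre in a regular scheme, `RegularCentreLocal.lean`).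
Then the affine piece `E_{x_j} = j⁻¹ X'[W, x_j]` of `E` has coordinate ring the polynomial ring
`(A/𝓘(W))[T_l : l ≠ j]`, the constants being `q^* i₀^*` and `T_l` the pulled-back ratio
`j^*(β^*x_l / β^*x_j)`:

* `exists_ringEquiv_sections_chart_mvPolynomial` — **`Γ(E, j⁻¹X'[W, x_j]) ≅ (A/𝓘(W))[T_l : l ≠ j]`**,
  `j^*β^*a ↦ ā`, `j^*T_{x_j x_l} ↦ T_l` — assembled from `Γ(E, j⁻¹X'[W, u]) ≅ A[𝓘(W)/u]/(u)`
  (`ExceptionalDivisorChartSections.lean`) and `(A/I)[T_l : l ≠ j] ≅ A[I/x_j]/(x_j)` for `x`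
  quasi-regular (`blowupAlgebraQuotEquiv`, Stacks 0BIQ; `BlowupAlgebraQuasiRegularChart.lean`).

This is the chartwise content of Hartshorne II Thm. 8.24 (b) / Liu Thm. 8.1.19 (b) (`E ≅ ℙ(𝓘/𝓘²)` is a
projective bundle over the centre), in the form consumed by the tree's `GeneratingSections`
(Hartshorne II 7.1/7.2: the chart ring maps `k[x_l/x_j] → Γ(E, E_{x_j})` are bijective).

## References

* [Hartshorne1977] R. Hartshorne, Algebraic Geometry (1977), II Thm. 8.24 (b).
* [Liu2002] Q. Liu, Algebraic Geometry and Arithmetic Curves (2002), Thm. 8.1.19 (b).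
* [StacksProject] The Stacks Project, Tag 0BIQ, Tag 0804.
-/

noncomputable section

open CategoryTheory CategoryTheory.Limits AlgebraicGeometry TopologicalSpace Opposite

namespace Literature.AlgebraicGeometry.Resolution

universe u

variable {X' M B : Scheme.{u}} {β : X' ⟶ M} {i₀ : B ⟶ M} [IsClosedImmersion i₀]

/-- Transport of `A[K/u] ⧸ (u)` along an equality of ideals `K = I` (the subalgebras `A[K/u]`,
`A[I/u]` of `A[1/u]` coincide): constants go to constants and generators `v/u` to generators. [folklore] -/
theorem exists_ringEquiv_quotient_blowupAlgebra_of_eq {A : Type u} [CommRing A] {K I : Ideal A}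
    (h : K = I) (u : A) :
    ∃ ψ : (blowupAlgebra K u ⧸ Ideal.span {algebraMap A (blowupAlgebra K u) u}) ≃+*
        (blowupAlgebra I u ⧸ Ideal.span {algebraMap A (blowupAlgebra I u) u}),
      (∀ a : A, ψ (Ideal.Quotient.mk _ (algebraMap A (blowupAlgebra K u) a)) =
        Ideal.Quotient.mk _ (algebraMap A (blowupAlgebra I u) a)) ∧
      ∀ (v : A) (hvK : v ∈ K) (hvI : v ∈ I),
        ψ (Ideal.Quotient.mk _ (blowupAlgebra.gen K u v hvK)) =
          Ideal.Quotient.mk _ (blowupAlgebra.gen I u v hvI) := by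
  subst h
  exact ⟨RingEquiv.refl _, fun _ ↦ RingEquiv.refl_apply _ _, fun _ _ _ ↦ RingEquiv.refl_apply _ _⟩

/-- **The affine piece `E_{x_j} = j⁻¹X'[W, x_j]` of the exceptional divisor is the affine space
`Spec (A/𝓘(W))[T_l : l ≠ j]` over the centre**, for `𝓘(W) = (x)` with `x` quasi-regular: a ring
isomorphism `Γ(E, j⁻¹X'[W, x_j]) ≅ (A/𝓘(W))[T_l : l ≠ j]` sending `j^*β^*a` to the constant `ā` and the
pulled-back ratio `j^*T_l` (`β^*x_l = β^*x_j · T_l`) to the variable `T_l` (Liu Thm. 8.1.19 (b), chart by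
chart; Stacks 0BIQ reduced modulo `x_j`). [cite: Liu2002, Thm. 8.1.19 (b)] [cite: StacksProject, Tag 0BIQ] -/
theorem exists_ringEquiv_sections_chart_mvPolynomial (hβ : IsBlowup β i₀.ker) (W : M.affineOpens)
    {n : ℕ} (x : Fin n → Γ(M, W)) (hgen : Ideal.span (Set.range x) = i₀.ker.ideal W)
    (hqr : IsQuasiRegular x) (j : Fin n) {T : Fin n → Γ(X', blowupChart β i₀.ker W (x j))}
    (hT : ∀ l, β.appLE W (blowupChart β i₀.ker W (x j)) (blowupChart_le_preimage β i₀.ker W (x j)) (x l) =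
      β.appLE W (blowupChart β i₀.ker W (x j)) (blowupChart_le_preimage β i₀.ker W (x j)) (x j) * T l) :
    ∃ Ψ : Γ(pullback β i₀, pullback.fst β i₀ ⁻¹ᵁ blowupChart β i₀.ker W (x j)) ≃+*
        MvPolynomial {l : Fin n // l ≠ j} (Γ(M, W) ⧸ Ideal.span (Set.range x)),
      (∀ a, Ψ ((pullback.fst β i₀).app (blowupChart β i₀.ker W (x j))
          (β.appLE W (blowupChart β i₀.ker W (x j)) (blowupChart_le_preimage β i₀.ker W (x j)) a)) =
        MvPolynomial.C (Ideal.Quotient.mk _ a)) ∧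
      ∀ l : {l : Fin n // l ≠ j}, Ψ ((pullback.fst β i₀).app (blowupChart β i₀.ker W (x j)) (T l)) =
        MvPolynomial.X l := by
  have hx : ∀ l, x l ∈ i₀.ker.ideal W := fun l ↦ hgen ▸ Ideal.subset_span ⟨l, rfl⟩
  -- `Γ(X', X'[W, x_j]) ≅ A[K/x_j]` and `Γ(E, E_{x_j}) ≅ A[K/x_j] ⧸ (x_j)`
  obtain ⟨e, he⟩ := hβ.exists_ringEquiv_blowupChart W (hx j)
  obtain ⟨ε, hε⟩ := exists_ringEquiv_sections_preimage_fst_blowupChart W hβ (hx j) e he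
  -- `A[K/x_j] ⧸ (x_j) ≅ A[I/x_j] ⧸ (x_j)`, `I = (x)`
  obtain ⟨ψ, hψ⟩ := exists_ringEquiv_quotient_blowupAlgebra_of_eq hgen.symm (x j)
  -- `A[I/x_j] ⧸ (x_j) ≅ (A/I)[T_l : l ≠ j]`
  let χ := (blowupAlgebraQuotEquiv x j hqr).symm
  -- (no `rw` on goals/hypotheses containing sections of `E` or `X'`: compose equalities forward)
  refine ⟨ε.trans (ψ.trans χ), fun a ↦ ?_, fun l ↦ ?_⟩
  · have h1 : ε ((pullback.fst β i₀).app (blowupChart β i₀.ker W (x j))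
        (β.appLE W (blowupChart β i₀.ker W (x j)) (blowupChart_le_preimage β i₀.ker W (x j)) a)) =
        Ideal.Quotient.mk _ (algebraMap Γ(M, W) (blowupAlgebra (i₀.ker.ideal W) (x j)) a) :=
      (hε _).trans (congrArg (Ideal.Quotient.mk _) (he a))
    have h3 : χ (Ideal.Quotient.mk _ (algebraMap Γ(M, W) (blowupAlgebra (Ideal.span (Set.range x)) (x j)) a)) =
        MvPolynomial.C (Ideal.Quotient.mk _ a) :=
      (blowupAlgebraQuotEquiv x j hqr).injective (by
        rw [RingEquiv.apply_symm_apply, blowupAlgebraQuotEquiv_C])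
    exact ((congrArg (fun z ↦ χ (ψ z)) h1).trans (congrArg χ (hψ.1 a))).trans h3
  · have h2 : ε ((pullback.fst β i₀).app (blowupChart β i₀.ker W (x j)) (T l)) =
        Ideal.Quotient.mk _ (blowupAlgebra.gen (i₀.ker.ideal W) (x j) (x l.1) (hx l.1)) :=
      (hε _).trans (congrArg (Ideal.Quotient.mk _) (ringEquiv_chartRatio W (hx l) e he (hT l)))
    have h3 : χ (Ideal.Quotient.mk _ (blowupAlgebra.gen (Ideal.span (Set.range x)) (x j) (x l.1)
        (Ideal.mem_span_range_self (f := x) (x := l.1)))) = MvPolynomial.X l :=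
      (blowupAlgebraQuotEquiv x j hqr).injective (by
        rw [RingEquiv.apply_symm_apply, blowupAlgebraQuotEquiv_X])
    exact ((congrArg (fun z ↦ χ (ψ z)) h2).trans
      (congrArg χ (hψ.2 (x l) (hx l) (Ideal.mem_span_range_self (f := x) (x := l.1))))).trans h3

end Literature.AlgebraicGeometry.Resolution

end
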